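import Literature.AlgebraicGeometry.Motives.SecOfForm
import Literature.AlgebraicGeometry.Motives.SecZeroScheme
import Literature.AlgebraicGeometry.Motives.ProjectiveDescentNormProofs
import Literature.AlgebraicGeometry.Resolution.GenericForms
import Mathlib.RingTheory.Algebraic.Basic
import Mathlib.RingTheory.KrullDimension.Field
import HarnessLib

/-!
# Forms of degree `m` on the affine charts of a closed subscheme of `ℙⁿ`: chart values and their span on curves

Topic: `Literature/AlgebraicGeometry/Resolution`. For a closed immersion `r : X ↪ ℙⁿ_k` of a
`k`-scheme and the chart `X_i = r⁻¹D₊(x_i)` (Hartshorne II Prop. 7.2: `Γ(X_i, 𝒪)` is generated by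
the ratios `r^*(x_j/x_i)`), this file computes the chart values of the hypersurface sections
`X ∩ V₊(G)`, `G = Σ_μ a_μ x^μ` a form of degree `m` (`Motives/SecOfForm`,
`Resolution/GenericForms`):

* `sectionsFun_formOfCoeffs` — `G(s)/s_i^m = Σ_μ a_μ c_μ` with `c_μ = x^μ(s)/s_i^m` the chart
  values of the monomials (`chartMonomial`);
* `chartMonomial_single`, `chartMonomial_pow` — `c_{m e_i} = 1` and
  `c_{(m-l) e_i + l e_j} = (x_j/x_i)^l`;
* `exists_eq_aeval_homRatio` — every section over `X_i` is a polynomial in the ratios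
  (Hartshorne II Prop. 7.2);
* **`add_one_le_finrank_span_chartMonomial`** — on a basic open `W = (X_i)_h` and modulo a prime
  `P` of `A = Γ(W)` with `dim A/P = 1` (an irreducible curve in the chart), the classes of the
  `c_μ` span a `k`-vector space of dimension `≥ m + 1`: some ratio `x_j/x_i` is transcendental
  modulo `P` (otherwise `A/P`, generated by the ratios and `1/h`, would be the field `k`), and
  `1, t, …, t^m` are among the `c_μ`. This is the input "the curve `i(C) ⊂ 𝐏` is not contained in
  any linear subspace of dimension `n - 1`" of de Jong's proof of Lemma 4.13 (de Jong 1996, p. 69)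
  in the form consumed by the dimension count (`GenericFormMissesFibreComponents`).

## References

* A. J. de Jong, *Smoothness, semi-stability and alterations*, Publ. Math. IHÉS 83 (1996),
  Lemma 4.13 (proof), p. 69. [DeJong1996]
* R. Hartshorne, *Algebraic Geometry*, GTM 52 (1977), II Prop. 7.2. [Hartshorne1977]
-/

noncomputable section

universe u

open CategoryTheory AlgebraicGeometry Limits HomogeneousLocalization TopologicalSpace Opposite
open MvPolynomial (X C eval₂Hom eval₂ monomial)
open Literature.AlgebraicGeometry.Motives Literature.AlgebraicGeometry.Motives.Segre
  Literature.AlgebraicGeometry.Motives.GeneratingSections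

attribute [local instance] MvPolynomial.gradedAlgebra

namespace Literature.AlgebraicGeometry.Resolution

/-! ### Algebra: powers of a transcendental element; algebras consisting of constants -/

section Algebra

variable {K R : Type*} [Field K] [CommRing R] [Algebra K R]

/-- The powers `1, t, …, t^m` of a transcendental element are linearly independent. [folklore] -/
theorem linearIndependent_pow_of_transcendental {t : R} (ht : Transcendental K t) (m : ℕ) :
    LinearIndependent K fun l : Fin (m + 1) => t ^ (l : ℕ) := by
  rw [Fintype.linearIndependent_iff]
  intro g hg l
  -- the polynomial `Σ g_l X^l` kills `t`
  set p : Polynomial K := ∑ l : Fin (m + 1), Polynomial.monomial (l : ℕ) (g l) with hp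
  have hpt : Polynomial.aeval t p = 0 := by
    simp only [hp, map_sum, Polynomial.aeval_monomial, ← Algebra.smul_def]
    exact hg
  have hp0 : p = 0 := by
    by_contra hne
    exact ht ⟨p, hne, hpt⟩
  have hcoeff : p.coeff (l : ℕ) = g l := by
    simp only [hp, Polynomial.finsetSum_coeff, Polynomial.coeff_monomial]
    rw [Finset.sum_eq_single l]
    · simp
    · intro b _ hb
      rw [if_neg]
      exact fun h => hb (Fin.ext h)
    · intro h; exact absurd (Finset.mem_univ l) h
  rw [← hcoeff, hp0, Polynomial.coeff_zero]

/-- Over an algebraically closed field, an algebraic element of a domain is a constant.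
[folklore] -/
theorem mem_range_algebraMap_of_isAlgebraic [IsAlgClosed K] [IsDomain R] {t : R}
    (ht : IsAlgebraic K t) : t ∈ (algebraMap K R).range := by
  have hint : IsIntegral K t := ht.isIntegral
  have hq : (minpoly K t).leadingCoeff = 1 := minpoly.monic hint
  have h : (minpoly K t).degree = 1 :=
    IsAlgClosed.degree_eq_one_of_irreducible K (minpoly.irreducible hint)
  have h0 : Polynomial.aeval t (minpoly K t) = 0 := minpoly.aeval K t
  rw [Polynomial.eq_X_add_C_of_degree_eq_one h, hq, Polynomial.C_1, one_mul, Polynomial.aeval_add,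
    Polynomial.aeval_X, Polynomial.aeval_C, add_eq_zero_iff_eq_neg] at h0
  exact ⟨-(minpoly K t).coeff 0, by rw [map_neg]; exact h0.symm⟩

/-- A `K`-algebra which is a domain and consists of constants is a field. [folklore] -/
theorem isField_of_forall_mem_range [IsDomain R] (h : ∀ x : R, x ∈ (algebraMap K R).range) :
    IsField R := by
  refine ⟨⟨0, 1, zero_ne_one⟩, mul_comm, fun {a} ha => ?_⟩
  obtain ⟨c, rfl⟩ := h a
  have hc : c ≠ 0 := fun h0 => ha (by rw [h0, map_zero])
  exact ⟨algebraMap K R c⁻¹, by rw [← map_mul, mul_inv_cancel₀ hc, map_one]⟩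

end Algebra

/-! ### Charts of a closed immersion into projective space -/

section ChartLift

variable {ι : Type} {k : Type u} [CommRing k] {Y : Scheme.{u}} (r : Y ⟶ Proj (grading ι k))

/-- Copy of `Motives.GeneratingSections.isClosedImmersion_chartLift`
(`Motives/GAGAKaehlerImmersionProofs.lean`, kept private here to avoid importing complex
analytic geometry): for a closed immersion `r`, the chart lift `r⁻¹D₊(xⱼ) → D₊(xⱼ)` is a closed
immersion. [folklore] -/
private theorem isClosedImmersion_chartLift' [IsClosedImmersion r] (j : ι) :
    IsClosedImmersion (chartLift r j) := by
  have hrange : Set.range (Proj.basicOpen (grading ι k) (X j)).ι = Set.range (chartι k j) := by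
    rw [Scheme.Opens.range_ι, ← Scheme.Hom.coe_opensRange, Proj.opensRange_awayι]
  let e := IsOpenImmersion.isoOfRangeEq (Proj.basicOpen (grading ι k) (X j)).ι (chartι k j) hrange
  have he : e.hom ≫ chartι k j = (Proj.basicOpen (grading ι k) (X j)).ι :=
    IsOpenImmersion.isoOfRangeEq_hom_fac _ _ _
  have hl : ((r ∣_ Proj.basicOpen (grading ι k) (X j)) ≫ e.hom) ≫ chartι k j =
      (preU r j).ι ≫ r := by
    rw [Category.assoc, he, morphismRestrict_ι]
  have hαl : (r ∣_ Proj.basicOpen (grading ι k) (X j)) ≫ e.hom = chartLift r j :=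
    IsOpenImmersion.lift_uniq _ _ _ _ hl
  rw [← hαl]
  infer_instance

/-- Copy of `Motives.GeneratingSections.pull_chartLift_surjective` (same file, same reason):
`(k[x]_{(xⱼ)})₀ → Γ(r⁻¹D₊(xⱼ), 𝒪)` is surjective for a closed immersion `r`
(Hartshorne II Prop. 7.2). [cite: Hartshorne1977, II Prop. 7.2] -/
private theorem pull_chartLift_surjective' [IsClosedImmersion r] (j : ι) :
    Function.Surjective (pull (chartLift r j)) := by
  haveI := isClosedImmersion_chartLift' r j
  intro s
  obtain ⟨t, ht⟩ := (IsClosedImmersion.isAffine_surjective_of_isAffine (chartLift r j)).2 s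
  obtain ⟨u, hu⟩ := (ConcreteCategory.bijective_of_isIso
    (Scheme.ΓSpecIso (.of (Away (grading ι k) (X j)))).inv).2 t
  exact ⟨u, by rw [pull_apply, hu, ht]⟩

/-- Copy of `Motives.GeneratingSections.exists_eq_eval₂_homRatio` (same file, same reason):
**sections over `r⁻¹D₊(xⱼ)` are polynomials in the ratios `r^*(xᵢ/xⱼ)`** for a closed immersion
`r`. [cite: Hartshorne1977, II Prop. 7.2] -/
private theorem exists_eq_eval₂_homRatio' [IsClosedImmersion r] (j : ι) (a : Γ(Y, preU r j)) :
    ∃ p : MvPolynomial ι k,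
      a = MvPolynomial.eval₂
        ((preU r j).topIso.hom.hom.comp ((pull (chartLift r j)).comp (cst k (X j))))
        (fun i ↦ homRatio r j i) p := by
  obtain ⟨s, hs⟩ := pull_chartLift_surjective' r j ((preU r j).topIso.inv a)
  obtain ⟨n, p, hp, rfl⟩ := Away.mk_surjective (grading ι k) (X_mem k j) s
  refine ⟨p, ?_⟩
  have ha : a = (preU r j).topIso.hom (pull (chartLift r j) (Away.mk _ (X_mem k j) n p hp)) := by
    rw [hs, ← CategoryTheory.comp_apply, Iso.inv_hom_id]
    rfl
  rw [ha, awayMk_eq_eval₂, ← RingHom.comp_apply, ← RingHom.comp_apply, ← RingHom.comp_assoc,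
    MvPolynomial.comp_eval₂Hom, MvPolynomial.coe_eval₂Hom]
  rfl

/-- Copy of `Motives.GeneratingSections.topIso_hom_pull_chartLift_cst` (same file, same reason):
the constants of the chart lift are the restrictions of the structure constants. [folklore] -/
private theorem topIso_hom_pull_chartLift_cst' (j : ι) (c : k) :
    (preU r j).topIso.hom (pull (chartLift r j) (cst k (X j) c)) =
      Y.presheaf.map (homOfLE (le_top : preU r j ≤ ⊤)).op (pull (r ≫ toSpec ι k) c) := by
  have h1 : pull (chartLift r j) (cst k (X j) c) =
      pull (chartLift r j ≫ Spec.map (CommRingCat.ofHom (cst k (X j)))) c := by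
    rw [pull_SpecMap]
    rfl
  rw [h1, ← chartι_toSpec, ← Category.assoc, chartLift_chartι, Category.assoc, pull_comp,
    RingHom.comp_apply]
  generalize pull (r ≫ toSpec ι k) c = t
  simp only [Scheme.Opens.ι_appTop, Scheme.Opens.topIso_hom]
  change (Y.presheaf.map _ ≫ Y.presheaf.map _).hom t = (Y.presheaf.map _).hom t
  rw [← Functor.map_comp]
  congr 3

end ChartLift

/-! ### The `k`-algebra of sections over a standard chart of a projective `k`-scheme -/

section Charts

variable {k : Type u} [Field k] {Z : SchemeOver k} {n : ℕ} (ι : Z ⟶ projectiveSpace n k)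

attribute [local instance] FieldNorm.secAlgebra

/-- The underlying morphism `X → ℙⁿ` of `ι`, with target spelled `Proj k[x₀, …, xₙ]`.
[folklore] -/
abbrev emb : Z.left ⟶ Proj (grading (Fin (n + 1)) k) := ι.left

/-- `ι` is a morphism over `k`: `emb ι ≫ (ℙⁿ → Spec k) = (Z → Spec k)`. [folklore] -/
theorem emb_toSpec : emb ι ≫ toSpec (Fin (n + 1)) k = Z.hom := Over.w ι

/-- The structure constants of the charts are the `k`-algebra structure of the sections:
`cstr c = c · 1 ∈ Γ(X, r⁻¹D₊(xᵢ))`. [folklore] -/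
theorem cstr_eq_algebraMap (i : Fin (n + 1)) (c : k) :
    (ofHom (emb ι)).cstr Z.hom i c = algebraMap k Γ(Z.left, preU (emb ι) i) c := by
  rw [FieldNorm.algebraMap_sec]
  simp only [GeneratingSections.cstr, pull, CommRingCat.hom_comp, RingHom.comp_apply,
    Scheme.Hom.appLE, Scheme.Hom.appTop]
  rfl

/-- The constants of the chart lift are the `k`-algebra structure. [folklore] -/
theorem topIso_pull_chartLift_cst_eq_algebraMap (i : Fin (n + 1)) :
    (preU (emb ι) i).topIso.hom.hom.comp ((pull (chartLift (emb ι) i)).comp (cst k (X i))) =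
      algebraMap k Γ(Z.left, preU (emb ι) i) := by
  apply RingHom.ext
  intro c
  rw [RingHom.comp_apply, RingHom.comp_apply, ← cstr_eq_algebraMap]
  change (preU (emb ι) i).topIso.hom (pull (chartLift (emb ι) i) (cst k (X i) c)) = _
  rw [topIso_hom_pull_chartLift_cst', emb_toSpec]
  rfl

/-- **Sections over the chart `X_i = r⁻¹D₊(xᵢ)` of a closed subscheme `r : X ↪ ℙⁿ_k` are
polynomials over `k` in the ratios `r^*(xⱼ/xᵢ)`** (Hartshorne II Prop. 7.2).
[cite: Hartshorne1977, II Prop. 7.2] -/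
theorem exists_eq_aeval_homRatio [IsClosedImmersion ι.left] (i : Fin (n + 1))
    (a : Γ(Z.left, preU (emb ι) i)) :
    ∃ p : MvPolynomial (Fin (n + 1)) k, a = MvPolynomial.aeval (fun j => homRatio (emb ι) i j) p := by
  haveI : IsClosedImmersion (emb ι) := ‹_›
  obtain ⟨p, hp⟩ := exists_eq_eval₂_homRatio' (emb ι) i a
  refine ⟨p, ?_⟩
  rw [hp, topIso_pull_chartLift_cst_eq_algebraMap, MvPolynomial.aeval_def]

/-! ### Chart values of monomials and forms -/

variable {m : ℕ}

/-- **The chart value `c_μ = x^μ(s)/sᵢᵐ ∈ Γ(X, r⁻¹D₊(xᵢ))` of the monomial `x^μ` of degree `m`**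
(the `i`-th chart value of the section `x^μ(s)` of `𝒪_X(m)`). [folklore] -/
def chartMonomial (i : Fin (n + 1)) (m : ℕ) (μ : Monomials (Fin (n + 1)) m) :
    Γ(Z.left, preU (emb ι) i) :=
  (ofHom (emb ι)).sectionsFun Z.hom i (monomial μ.1 1)

/-- `c_μ = Πⱼ (xⱼ/xᵢ)^{μⱼ}`. [folklore] -/
theorem chartMonomial_eq_prod (i : Fin (n + 1)) (μ : Monomials (Fin (n + 1)) m) :
    chartMonomial ι i m μ = ∏ j, homRatio (emb ι) i j ^ (μ.1 j) := by
  unfold chartMonomial GeneratingSections.sectionsFun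
  rw [MvPolynomial.coe_eval₂Hom, MvPolynomial.eval₂_monomial, map_one, one_mul,
    Finsupp.prod_fintype _ _ (fun j => pow_zero _)]
  rfl

/-- **The chart value of a form is the combination of the chart values of the monomials**:
`G(s)/sᵢᵐ = Σ_μ a_μ c_μ` for `G = Σ_μ a_μ x^μ`. [folklore] -/
theorem sectionsFun_formOfCoeffs (i : Fin (n + 1)) (a : Monomials (Fin (n + 1)) m → k) :
    (ofHom (emb ι)).sectionsFun Z.hom i (formOfCoeffs a) = ∑ μ, a μ • chartMonomial ι i m μ := by
  unfold formOfCoeffs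
  rw [map_sum]
  refine Finset.sum_congr rfl fun μ _ => ?_
  have h1 : (monomial μ.1 (a μ) : MvPolynomial (Fin (n + 1)) k) = C (a μ) * monomial μ.1 1 := by
    rw [MvPolynomial.C_mul_monomial, mul_one]
  rw [h1, map_mul, GeneratingSections.sectionsFun_C, cstr_eq_algebraMap, Algebra.smul_def]
  rfl

/-- The exponent `m eᵢ` of `xᵢᵐ`. [folklore] -/
def monoSelf (i : Fin (n + 1)) (m : ℕ) : Monomials (Fin (n + 1)) m :=
  ⟨Finsupp.single i m, by simp [Finsupp.degree_single]⟩

/-- The exponent `(m - l) eᵢ + l eⱼ` of `xᵢ^{m-l} xⱼ^l`, `l ≤ m`. [folklore] -/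
def monoPow (i j : Fin (n + 1)) (m : ℕ) (l : Fin (m + 1)) : Monomials (Fin (n + 1)) m :=
  ⟨Finsupp.single i (m - (l : ℕ)) + Finsupp.single j (l : ℕ), by
    have := l.2
    simp only [map_add, Finsupp.degree_single]
    omega⟩

/-- `c_{m eᵢ} = (xᵢ/xᵢ)^m = 1`. [folklore] -/
theorem chartMonomial_monoSelf (i : Fin (n + 1)) : chartMonomial ι i m (monoSelf i m) = 1 := by
  rw [chartMonomial_eq_prod, Finset.prod_eq_single i]
  · change homRatio (emb ι) i i ^ (Finsupp.single i m i) = 1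
    rw [homRatio_self, one_pow]
  · intro j _ hj
    change homRatio (emb ι) i j ^ (Finsupp.single i m j) = 1
    rw [Finsupp.single_eq_of_ne hj, pow_zero]
  · intro h; exact absurd (Finset.mem_univ i) h

/-- `c_{(m-l) eᵢ + l eⱼ} = (xⱼ/xᵢ)^l` for `j ≠ i`. [folklore] -/
theorem chartMonomial_monoPow {i j : Fin (n + 1)} (hj : j ≠ i) (l : Fin (m + 1)) :
    chartMonomial ι i m (monoPow i j m l) = homRatio (emb ι) i j ^ (l : ℕ) := by
  classical
  rw [chartMonomial_eq_prod]
  have key : ∀ t, homRatio (emb ι) i t ^ ((monoPow i j m l).1 t) =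
      if t = j then homRatio (emb ι) i j ^ (l : ℕ) else 1 := by
    intro t
    change homRatio (emb ι) i t ^ ((Finsupp.single i (m - (l : ℕ)) + Finsupp.single j (l : ℕ)) t) = _
    rw [Finsupp.add_apply]
    by_cases ht : t = j
    · subst ht
      rw [if_pos rfl, Finsupp.single_eq_of_ne hj, Finsupp.single_eq_same, zero_add]
    · rw [if_neg ht, Finsupp.single_eq_of_ne ht, add_zero]
      by_cases hti : t = i
      · subst hti; rw [homRatio_self, one_pow]
      · rw [Finsupp.single_eq_of_ne hti, pow_zero]
  simp only [key, Finset.prod_ite_eq', Finset.mem_univ, if_true]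

end Charts

/-! ### The span of the chart values of the monomials on a curve -/

section Span

variable {k : Type u} [Field k] [IsAlgClosed k] {Z : SchemeOver k} {n : ℕ}
  (ι : Z ⟶ projectiveSpace n k) [IsClosedImmersion ι.left]

attribute [local instance] FieldNorm.secAlgebra

/-- **On a curve in a chart, the chart values of the monomials of degree `m` span at least
`m + 1` dimensions.** Let `r : Z ↪ ℙⁿ_k` be a closed immersion over an algebraically closed field,
`W = (r⁻¹D₊(xᵢ))_h` a basic open of the `i`-th chart, `A = Γ(Z, W)` and `P ⊂ A` a prime with
`dim A/P ≠ 0`. Then the classes in `A/P` of the chart values `c_μ|_W`, `|μ| = m`, span a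
`k`-vector space of dimension `≥ m + 1`: `A/P` is generated over `k` by the ratios `xⱼ/xᵢ` and
`1/h` (Hartshorne II Prop. 7.2), so if every ratio were algebraic — i.e. a constant, `k` being
algebraically closed — `A/P` would be the field `k`; hence some `t = xⱼ/xᵢ` is transcendental
modulo `P`, and `1, t, …, tᵐ` are classes of chart values (`chartMonomial_monoPow`). This is
de Jong's "the curve `i(C) ⊂ 𝐏` is not contained in any linear subspace" for the embedding by
forms of degree `m` (de Jong 1996, proof of 4.13, p. 69).
[cite: DeJong1996, Lemma 4.13 (proof), p. 69] -/
theorem add_one_le_finrank_span_chartMonomial (i : Fin (n + 1)) (h : Γ(Z.left, preU (emb ι) i))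
    (m : ℕ) (P : Ideal Γ(Z.left, Z.left.basicOpen h)) [P.IsPrime]
    (hP : ringKrullDim (Γ(Z.left, Z.left.basicOpen h) ⧸ P) ≠ 0) :
    m + 1 ≤ Module.finrank k (Submodule.span k (Set.range fun μ : Monomials (Fin (n + 1)) m =>
      Ideal.Quotient.mk P (Z.left.presheaf.map (homOfLE (Z.left.basicOpen_le h)).op
        (chartMonomial ι i m μ)))) := by
  classical
  -- notation: `rsW = res : Γ(Xᵢ) → Γ(W)`, `π : Γ(W) → Γ(W)/P`
  have hWle : Z.left.basicOpen h ≤ preU (emb ι) i := Z.left.basicOpen_le h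
  set rsW : Γ(Z.left, preU (emb ι) i) →+* Γ(Z.left, Z.left.basicOpen h) :=
    (Z.left.presheaf.map (homOfLE (Z.left.basicOpen_le h)).op).hom with hrsW
  set π := Ideal.Quotient.mk P with hπ
  haveI : IsDomain (Γ(Z.left, Z.left.basicOpen h) ⧸ P) := Ideal.Quotient.isDomain P
  -- `π ∘ rsW` is a `k`-algebra map
  have hπk : ∀ c : k, π (rsW (algebraMap k _ c)) = algebraMap k _ c := fun c => by
    rw [hrsW, FieldNorm.map_algebraMap_sec (Z.left.basicOpen_le h) c]
    rfl
  let θ : Γ(Z.left, preU (emb ι) i) →ₐ[k] Γ(Z.left, Z.left.basicOpen h) ⧸ P :=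
    { toRingHom := π.comp rsW, commutes' := hπk }
  have hθ : ∀ b, θ b = π (rsW b) := fun b => rfl
  -- the ratios modulo `P`
  set t : Fin (n + 1) → Γ(Z.left, Z.left.basicOpen h) ⧸ P :=
    fun j => π (rsW (homRatio (emb ι) i j)) with ht
  -- every section over the chart is a polynomial in the ratios, so `θ b ∈ k[t]`
  have hθpoly : ∀ b : Γ(Z.left, preU (emb ι) i), ∃ p : MvPolynomial (Fin (n + 1)) k,
      θ b = MvPolynomial.aeval t p := fun b => by
    obtain ⟨p, rfl⟩ := exists_eq_aeval_homRatio ι i b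
    refine ⟨p, ?_⟩
    rw [← AlgHom.comp_apply, MvPolynomial.comp_aeval]
    rfl
  by_cases htr : ∃ j, Transcendental k (t j)
  · -- some ratio is transcendental: `1, t, …, t^m` are independent classes of chart values
    obtain ⟨j, hj⟩ := htr
    have hji : j ≠ i := by
      rintro rfl
      apply hj
      have : t j = algebraMap k _ 1 := by
        simp only [ht, homRatio_self, map_one]
      rw [this]
      exact isAlgebraic_algebraMap 1
    have hli := linearIndependent_pow_of_transcendental hj m
    set S := Submodule.span k (Set.range fun μ : Monomials (Fin (n + 1)) m =>
      π (rsW (chartMonomial ι i m μ))) with hS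
    haveI : Module.Finite k S := Module.Finite.span_of_finite k (Set.finite_range _)
    have hmem : ∀ l : Fin (m + 1), t j ^ (l : ℕ) ∈ S := fun l => by
      have : t j ^ (l : ℕ) = π (rsW (chartMonomial ι i m (monoPow i j m l))) := by
        rw [chartMonomial_monoPow ι hji l, map_pow, map_pow]
      rw [this]
      exact Submodule.subset_span ⟨monoPow i j m l, rfl⟩
    let v : Fin (m + 1) → S := fun l => ⟨t j ^ (l : ℕ), hmem l⟩
    have hv : LinearIndependent k v := LinearIndependent.of_comp S.subtype hli
    have := hv.fintype_card_le_finrank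
    rw [Fintype.card_fin] at this
    exact this
  · -- all ratios algebraic: `A/P` consists of constants, hence is a field — contradiction
    push Not at htr
    exfalso
    have htc : ∀ j, t j ∈ (algebraMap k (Γ(Z.left, Z.left.basicOpen h) ⧸ P)).range := fun j =>
      mem_range_algebraMap_of_isAlgebraic (K := k) (by
        have := htr j
        unfold Transcendental at this
        push Not at this
        exact this)
    choose cj hcj using htc
    -- `θ b` is a constant for every `b`
    have hθc : ∀ b, ∃ e : k, algebraMap k _ e = θ b := fun b => by
      obtain ⟨p, hp⟩ := hθpoly b
      rw [hp]
      have hteq : t = fun j => algebraMap k _ (cj j) := funext fun j => (hcj j).symm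
      rw [hteq]
      refine ⟨MvPolynomial.eval cj p, ?_⟩
      have : (MvPolynomial.aeval fun j => algebraMap k (Γ(Z.left, Z.left.basicOpen h) ⧸ P) (cj j)) =
          (Algebra.ofId k _).comp (MvPolynomial.aeval cj) := by
        apply MvPolynomial.algHom_ext
        intro j
        simp
      rw [this, AlgHom.comp_apply, Algebra.ofId_apply]
      congr 1
    -- the unit `h` becomes a non-zero constant
    haveI : IsClosedImmersion (emb ι) := ‹_›
    haveI hloc : IsLocalization.Away h Γ(Z.left, Z.left.basicOpen h) :=
      (isAffineOpen_ofHom_U (emb ι) i).isLocalization_basicOpen h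
    have hunit : IsUnit (π (rsW h)) :=
      (IsLocalization.Away.algebraMap_isUnit (S := Γ(Z.left, Z.left.basicOpen h)) h).map π
    obtain ⟨d, hd⟩ := hθc h
    have hd0 : d ≠ 0 := by
      rintro rfl
      rw [map_zero] at hd
      rw [← hθ, ← hd] at hunit
      exact not_isUnit_zero hunit
    -- every element of `A/P` is a constant
    have hall : ∀ x : Γ(Z.left, Z.left.basicOpen h) ⧸ P, x ∈ (algebraMap k _).range := by
      intro x
      obtain ⟨a, rfl⟩ := Ideal.Quotient.mk_surjective x
      obtain ⟨⟨b, ⟨_, N, rfl⟩⟩, hab⟩ := IsLocalization.surj (Submonoid.powers h) a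
      obtain ⟨e, he⟩ := hθc b
      -- `π a * d^N = e`
      have h1 : π a * (algebraMap k _ d) ^ N = algebraMap k _ e := by
        rw [hd, he, hθ, hθ, ← map_pow, ← map_mul, ← map_pow]
        congr 1
      have hinj : Function.Injective (algebraMap k (Γ(Z.left, Z.left.basicOpen h) ⧸ P)) :=
        (algebraMap k _).injective
      have hdN : (algebraMap k (Γ(Z.left, Z.left.basicOpen h) ⧸ P) d) ^ N ≠ 0 :=
        pow_ne_zero _ ((map_ne_zero_iff _ hinj).mpr hd0)
      refine ⟨e * d⁻¹ ^ N, ?_⟩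
      apply mul_right_cancel₀ hdN
      change _ = π a * _
      rw [h1, map_mul, map_pow, mul_assoc, ← mul_pow, ← map_mul, inv_mul_cancel₀ hd0, map_one,
        one_pow, mul_one]
    have hF := isField_of_forall_mem_range hall
    apply hP
    convert ringKrullDim_eq_zero_of_isField hF

end Span

end Literature.AlgebraicGeometry.Resolution
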